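import Mathlib
import HarnessLib
import Summits.ValiantsHypothesis.ValiantsHypothesis.Theorems.LacunarySymmetroidMatrixDescartesOsculationLawUniformAll

/-!
# ValiantsHypothesis / LacunarySymmetroid — crux `MatrixDescartes` (stmt-ValiantsHypothesis-18050, V1), line «osculation-law»:
# the all-format Descartes ceiling SHARPENED — `OsculationLawAt m K (m · multichoose K (20 m²))`, i.e. `2^(O(K·log m))`

Same argument as part 6 (`osculationLawAt_all`), with ONE bookkeeping change: the number of monomials of a polynomial whose
exponents lie in the `W`-fold sumset `W • E` of a `K`-set `E` is at most the number of multisets, `multichoose K W = C(K+W−1, W)`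
(`card_nsmul_le_multichoose`, from Mathlib's `Sym.card_sym_eq_multichoose`), instead of `K^W`.  Hence
`#osc ≤ m · C(K + 20m² − 1, 20m²) ≤ m · (e (1 + 20m²/K))^K`: POLYNOMIAL in `m` for fixed `K` (degree `≤ 40K + 1`... of order `m^(2K+1)`),
singly exponential in `K` for fixed `m` — `2^(O(K · log m))` (`osculationLawAt_all_multichoose`).  CALIBRATION against the
line's LAW `stub_osculationLaw : ∃ C, ∀ m K, OsculationLawAt m K (2^(C (K + log₂² m)))`: `K·log m ≤ C (K + log² m)` holds iff
`K = O(log m)` or `m = O(1)` — so this rung proves the LAW's inequality (with some constant) exactly OUTSIDE the window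
«`m` large and `K ≫ log m`», which is therefore where the crux lives.  See `HOME/lmr/NOTE-p5g12-18050-LAW-calibration.md`.

HONEST FRAMING: still a Descartes ceiling, NOT `stub_osculationLaw`; `MatrixDescartes`, Conjecture B, `VP ≠ VNP` NOT proved.  No
definitions, no named facts; Mathlib + tree files.
-/

-- `Summit.ValiantsHypothesis.ValiantsHypothesis.…` is the tree's mandated single-conjunct layout (Sub = Summit).
set_option linter.dupNamespace false

set_option maxRecDepth 100000

noncomputable section

namespace Summit.ValiantsHypothesis.ValiantsHypothesis.Theorems.LacunarySymmetroidMatrixDescartes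

namespace OsculationUniform

open Polynomial Set
open scoped BigOperators Pointwise
open Literature.Algebra.Polynomial Literature.Algebra.Polynomial.Subresultant Literature.Algebra.Polynomial.ModularEEA

/-! ### Sumsets are images of multisets: `|W • E| ≤ multichoose |E| W` -/

/-- Every element of `n • E` is the sum of a multiset of `n` elements of `E`. [folklore] -/
theorem exists_sym_sum_eq (E : Finset ℕ) : ∀ (n : ℕ) (x : ℕ), x ∈ n • E →
    ∃ s : Sym {e // e ∈ E} n, ((s : Multiset {e // e ∈ E}).map Subtype.val).sum = x := by
  intro n
  induction n with
  | zero =>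
    intro x hx
    rw [zero_nsmul, Finset.mem_zero] at hx
    subst hx
    exact ⟨Sym.nil, by simp⟩
  | succ n ih =>
    intro x hx
    rw [succ_nsmul, Finset.mem_add] at hx
    obtain ⟨y, hy, e, he, rfl⟩ := hx
    obtain ⟨s, hs⟩ := ih y hy
    refine ⟨Sym.cons ⟨e, he⟩ s, ?_⟩
    rw [Sym.coe_cons, Multiset.map_cons, Multiset.sum_cons, hs, add_comm]

/-- **`|n • E| ≤ multichoose |E| n`** (`= C(|E| + n − 1, n)`, the number of `n`-multisets from `E`). [folklore] -/
theorem card_nsmul_le_multichoose (E : Finset ℕ) (n : ℕ) : (n • E).card ≤ Nat.multichoose E.card n := by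
  classical
  have hsub : n • E ⊆ (Finset.univ : Finset (Sym {e // e ∈ E} n)).image
      (fun s : Sym {e // e ∈ E} n => ((s : Multiset {e // e ∈ E}).map Subtype.val).sum) := by
    intro x hx
    obtain ⟨s, hs⟩ := exists_sym_sum_eq E n x hx
    exact Finset.mem_image.2 ⟨s, Finset.mem_univ _, hs⟩
  refine (Finset.card_le_card hsub).trans (Finset.card_image_le.trans ?_)
  rw [Finset.card_univ, Sym.card_sym_eq_multichoose, Fintype.card_coe]

/-- `multichoose` is monotone in the alphabet size. [folklore] -/
theorem multichoose_mono_left {a b : ℕ} (h : a ≤ b) (n : ℕ) : Nat.multichoose a n ≤ Nat.multichoose b n := by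
  rw [Nat.multichoose_eq, Nat.multichoose_eq]
  exact Nat.choose_le_choose n (by omega)

/-- `multichoose` is monotone in the multiset size when the alphabet is nonempty. [folklore] -/
theorem multichoose_mono_right {a n m : ℕ} (ha : 1 ≤ a) (h : n ≤ m) : Nat.multichoose a n ≤ Nat.multichoose a m := by
  rw [Nat.multichoose_eq, Nat.multichoose_eq, ← Nat.choose_symm (show n ≤ a + n - 1 by omega),
    ← Nat.choose_symm (show m ≤ a + m - 1 by omega), show a + n - 1 - n = a - 1 by omega,
    show a + m - 1 - m = a - 1 by omega]
  exact Nat.choose_le_choose (a - 1) (by omega)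

/-- Monomial count from a sumset bound, multiset form. [folklore] -/
theorem card_support_le_multichoose {E : Finset ℕ} {p : ℝ[X]} {W X : ℕ} (hp : p.support ⊆ W • E) (hW : W ≤ X)
    (hE : 1 ≤ E.card) : p.support.card ≤ Nat.multichoose E.card X :=
  ((Finset.card_le_card hp).trans (card_nsmul_le_multichoose E W)).trans (multichoose_mono_right hE hW)

/-! ### The uniform count, multiset form -/

/-- **THE UNIFORM COUNT, multiset form**: as `uniform_count`, with `|E|^X` replaced by `multichoose |E| X`. -/
theorem uniform_count_multichoose (E : Finset ℕ) (P Q : ℝ[X][X]) (α β : ℕ)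
    (hP₁ : ∀ j, j ≤ α → (P.coeff j).support ⊆ (α - j) • E) (hP₂ : ∀ j, α < j → P.coeff j = 0)
    (hQ₁ : ∀ j, j ≤ β → (Q.coeff j).support ⊆ (β - j) • E) (hQ₂ : ∀ j, β < j → Q.coeff j = 0)
    (hsplit : ∀ t : ℝ, 0 < t → (P.map (evalRingHom t)).Splits)
    (hPQ : ∀ t : ℝ, P.map (evalRingHom t) = 0 → Q.map (evalRingHom t) = 0)
    (osc : Set (Fin 2 → ℝ))
    (hosc : ∀ p : Fin 2 → ℝ, p ∈ osc ↔ 0 < p 0 ∧ 0 < p 1 ∧ (P.map (evalRingHom (p 0))).IsRoot (p 1) ∧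
      (Q.map (evalRingHom (p 0))).IsRoot (p 1))
    (hfin : osc.Finite) :
    osc.ncard ≤ α * Nat.multichoose E.card ((α + β) ^ 2 + (α + β)) := by
  classical
  have hnP : P.natDegree ≤ α := natDegree_le_of_isobaric P α hP₂
  have hnQ : Q.natDegree ≤ β := natDegree_le_of_isobaric Q β hQ₂
  /- (0) `P = 0`: every point of the quadrant is in `osc`, which is then infinite. -/
  rcases eq_or_ne P 0 with hP0 | hP0
  · exfalso
    apply hfin.not_infinite
    refine OsculationCuspGen.infinite_of_vertical 1 fun b hb => (hosc _).2 ⟨?_, ?_, ?_, ?_⟩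
    · simp
    · simpa using hb
    · simp only [Matrix.cons_val_zero, Matrix.cons_val_one, hP0, Polynomial.map_zero]
      exact IsRoot.def.2 (eval_zero)
    · simp only [Matrix.cons_val_zero, Matrix.cons_val_one]
      rw [hPQ 1 (by rw [hP0, Polynomial.map_zero])]
      exact IsRoot.def.2 (eval_zero)
  /- (1) the empty alphabet: `P = C(c₀)·b^α` with `c₀ ≠ 0` has no positive zeros, `osc = ∅`. -/
  rcases Nat.eq_zero_or_pos E.card with hE0 | hEpos
  · have hE : E = ∅ := Finset.card_eq_zero.1 hE0
    have hcoeffP : ∀ j, j ≠ α → P.coeff j = 0 := by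
      intro j hj
      rcases Nat.lt_or_ge α j with h | h
      · exact hP₂ j h
      · have hs := hP₁ j h
        rw [hE, nsmul_empty (α - j) (by omega)] at hs
        exact Polynomial.support_eq_empty.1 (Finset.subset_empty.1 hs)
    have hsuppα : (P.coeff α).support ⊆ {0} := by
      have hs := hP₁ α le_rfl
      rwa [Nat.sub_self, zero_nsmul] at hs
    set c₀ : ℝ := (P.coeff α).coeff 0 with hc₀def
    have hcα : P.coeff α = C c₀ := by
      ext j
      rcases j with _ | j
      · rw [coeff_C_zero]
      · rw [coeff_C_succ]
        by_contra hne
        have := hsuppα (mem_support_iff.2 hne)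
        simp at this
    have hc0 : c₀ ≠ 0 := by
      intro h0
      apply hP0
      ext j : 1
      rcases eq_or_ne j α with rfl | hj
      · rw [hcα, h0, map_zero, coeff_zero]
      · rw [hcoeffP j hj, coeff_zero]
    have hempty : osc = ∅ := by
      ext p
      simp only [Set.mem_empty_iff_false, iff_false]
      intro hp
      obtain ⟨-, hb, hProot, -⟩ := (hosc p).1 hp
      have hval : (P.map (evalRingHom (p 0))).eval (p 1) = c₀ * p 1 ^ α := by
        have hPform : P = C (C c₀) * X ^ α := by
          ext j : 1
          rw [coeff_C_mul_X_pow]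
          split_ifs with h
          · rw [h, hcα]
          · exact hcoeffP j h
        have e1 : (P.map (evalRingHom (p 0))).eval (p 1) =
            ((C (C c₀) * X ^ α : ℝ[X][X]).map (evalRingHom (p 0))).eval (p 1) := by rw [← hPform]
        rw [e1, Polynomial.map_mul, Polynomial.map_pow, map_X, map_C, eval_mul, eval_pow, eval_X, eval_C,
          coe_evalRingHom, eval_C]
      have := hProot.eq_zero
      rw [hval] at this
      rcases mul_eq_zero.1 this with h | h
      · exact hc0 h
      · exact absurd (pow_eq_zero_iff'.1 h).1 hb.ne'
    rw [hempty, Set.ncard_empty]; exact Nat.zero_le _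
  have hE1 : 1 ≤ E.card := hEpos
  /- (2) `Q = 0`: the row is `P(t,·)/lc P(t)` and `Pex = lc P`. -/
  rcases eq_or_ne Q 0 with hQ0 | hQ0
  · have hPex : P.leadingCoeff ≠ 0 := leadingCoeff_ne_zero.2 hP0
    have hroots : ∀ p ∈ osc, P.leadingCoeff.IsRoot (p 0) := by
      refine abscissa_isRoot P Q osc hosc hfin hsplit P P.leadingCoeff P.leadingCoeff
        (fun t _ h => map_ne_zero_of_eval_leadingCoeff h) fun t _ h => ?_
      have hPt : P.map (evalRingHom t) ≠ 0 := map_ne_zero_of_eval_leadingCoeff h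
      have hlu : lu (P.map (evalRingHom t)) = P.leadingCoeff.eval t := by
        rw [lu_of_ne_zero hPt, leadingCoeff_map_of_leadingCoeff_ne_zero (evalRingHom t) (by exact h)]; rfl
      have hnf : C (P.leadingCoeff.eval t)⁻¹ * P.map (evalRingHom t) = normalForm (P.map (evalRingHom t)) := by
        rw [normalForm, hlu]
      refine ⟨h, by rw [hnf]; exact monic_normalForm hPt, ⟨C (P.leadingCoeff.eval t), ?_⟩, fun β hPβ _ => ?_,
        fun β _ => ?_⟩
      · rw [mul_comm, ← mul_assoc, ← C_mul, mul_inv_cancel₀ h, C_1, one_mul]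
      · rw [IsRoot, eval_mul, hPβ.eq_zero, mul_zero]
      · rw [hQ0, Polynomial.map_zero]; exact IsRoot.def.2 (eval_zero)
    refine (ncard_le_of_abscissa_isRoot P Q osc hosc hfin hPQ _ hPex hroots).trans ?_
    refine Nat.mul_le_mul hnP ?_
    refine card_support_le_multichoose (supp_leadingCoeff_isobaric E P α hP₁ hP₂) ?_ hE1
    nlinarith [Nat.sub_le α P.natDegree]
  /- (3) the generic case: subresultants of the pair ordered by `b`-degree. -/
  -- choose the order
  obtain ⟨f, g, hfg, hmn⟩ : ∃ f g : ℝ[X][X], ((f = P ∧ g = Q) ∨ (f = Q ∧ g = P)) ∧ g.natDegree ≤ f.natDegree := by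
    rcases le_total Q.natDegree P.natDegree with h | h
    · exact ⟨P, Q, Or.inl ⟨rfl, rfl⟩, h⟩
    · exact ⟨Q, P, Or.inr ⟨rfl, rfl⟩, h⟩
  have hf0 : f ≠ 0 := by rcases hfg with ⟨rfl, -⟩ | ⟨rfl, -⟩ <;> assumption
  have hg0 : g ≠ 0 := by rcases hfg with ⟨-, rfl⟩ | ⟨-, rfl⟩ <;> assumption
  -- isobaric data of `f` and `g`
  obtain ⟨αf, αg, hf₁, hf₂, hg₁, hg₂, hsum⟩ : ∃ αf αg : ℕ,
      (∀ j, j ≤ αf → (f.coeff j).support ⊆ (αf - j) • E) ∧ (∀ j, αf < j → f.coeff j = 0) ∧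
      (∀ j, j ≤ αg → (g.coeff j).support ⊆ (αg - j) • E) ∧ (∀ j, αg < j → g.coeff j = 0) ∧ αf + αg = α + β := by
    rcases hfg with ⟨rfl, rfl⟩ | ⟨rfl, rfl⟩
    · exact ⟨α, β, hP₁, hP₂, hQ₁, hQ₂, rfl⟩
    · exact ⟨β, α, hQ₁, hQ₂, hP₁, hP₂, Nat.add_comm β α⟩
  have hnf : f.natDegree ≤ αf := natDegree_le_of_isobaric f αf hf₂
  have hng : g.natDegree ≤ αg := natDegree_le_of_isobaric g αg hg₂
  -- the least index with a non-vanishing subresultant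
  have hex : ∃ k, subresultant f g k ≠ 0 :=
    ⟨g.natDegree, by rw [subresultant_natDegree_right]; exact pow_ne_zero _ (leadingCoeff_ne_zero.2 hg0)⟩
  set k := Nat.find hex with hk
  have hσk : subresultant f g k ≠ 0 := Nat.find_spec hex
  have hkm : k ≤ g.natDegree := Nat.find_le (by
    rw [subresultant_natDegree_right]; exact pow_ne_zero _ (leadingCoeff_ne_zero.2 hg0))
  have hlow : ∀ j < k, subresultant f g j = 0 := fun j hj => by
    by_contra hne; exact Nat.find_min hex hj hne
  -- the exceptional polynomial
  set Pex : ℝ[X] := f.leadingCoeff * g.leadingCoeff * subresultant f g k with hPexdef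
  have hPex : Pex ≠ 0 := mul_ne_zero (mul_ne_zero (leadingCoeff_ne_zero.2 hf0) (leadingCoeff_ne_zero.2 hg0)) hσk
  obtain ⟨N, D, hrow⟩ := row_data P Q f g hfg rfl rfl hmn hkm hlow
  have hPne : ∀ t : ℝ, 0 < t → Pex.eval t ≠ 0 → P.map (evalRingHom t) ≠ 0 := by
    intro t _ hPext
    apply map_ne_zero_of_eval_leadingCoeff
    rw [hPexdef, eval_mul, eval_mul] at hPext
    rcases hfg with ⟨rfl, -⟩ | ⟨-, rfl⟩
    · exact fun h0 => hPext (by rw [h0, zero_mul, zero_mul])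
    · exact fun h0 => hPext (by rw [h0, mul_zero, zero_mul])
  have hroots := abscissa_isRoot P Q osc hosc hfin hsplit N D Pex hPne hrow
  refine (ncard_le_of_abscissa_isRoot P Q osc hosc hfin hPQ Pex hPex hroots).trans (Nat.mul_le_mul hnP ?_)
  -- the monomial count of `Pex`
  obtain ⟨W, hW, hsW⟩ := supp_subresultant E f g αf αg hf₁ hf₂ hg₁ hg₂ k
  have hsPex : Pex.support ⊆ ((αf - f.natDegree) + (αg - g.natDegree) + W) • E :=
    OsculationCusp.supp_mul (OsculationCusp.supp_mul (supp_leadingCoeff_isobaric E f αf hf₁ hf₂)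
      (supp_leadingCoeff_isobaric E g αg hg₁ hg₂)) hsW
  refine card_support_le_multichoose hsPex ?_ hE1
  have h1 : W ≤ (αf + αg) ^ 2 := by
    refine hW.trans ?_
    nlinarith [hnf, hng, Nat.zero_le αf, Nat.zero_le αg, Nat.zero_le f.natDegree, Nat.zero_le g.natDegree]
  have h2 : αf - f.natDegree + (αg - g.natDegree) ≤ αf + αg := by omega
  rw [← hsum]
  omega


/-- Exponent bookkeeping, multiset form. [folklore] -/
theorem final_arith_multichoose (μ K c : ℕ) (hc : c ≤ K) :
    μ * Nat.multichoose c ((μ + 3 * μ) ^ 2 + (μ + 3 * μ)) ≤ μ * Nat.multichoose K (20 * μ ^ 2) := by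
  rcases Nat.eq_zero_or_pos μ with hμ | hμ
  · subst hμ; simp
  have hX : (μ + 3 * μ) ^ 2 + (μ + 3 * μ) ≤ 20 * μ ^ 2 := by nlinarith
  rcases Nat.eq_zero_or_pos c with h0 | h0
  · subst h0
    obtain ⟨x, hx⟩ : ∃ x, (μ + 3 * μ) ^ 2 + (μ + 3 * μ) = x + 1 :=
      ⟨(μ + 3 * μ) ^ 2 + (μ + 3 * μ) - 1, (Nat.sub_add_cancel (show 1 ≤ (μ + 3 * μ) ^ 2 + (μ + 3 * μ) by nlinarith)).symm⟩
    rw [hx, Nat.multichoose_zero_succ, mul_zero]; exact Nat.zero_le _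
  · exact Nat.mul_le_mul le_rfl ((multichoose_mono_left hc _).trans (multichoose_mono_right (by omega) hX))

/-- **One column, any splitting, multiset form.** -/
theorem column_of_family_multichoose (r s K : ℕ) (d : Fin K → ℕ) (c : ℕ → ℝ[X]) (Φ : MvPolynomial (Fin 2) ℝ)
    (hΦ : Φ = ∑ k ∈ Finset.range (r + 1), (MvPolynomial.X 1 : MvPolynomial (Fin 2) ℝ) ^ k *
      Polynomial.aeval (MvPolynomial.X 0 : MvPolynomial (Fin 2) ℝ) (c k))
    (hc : ∀ k, k ≤ r → (c k).support ⊆ (r + s - k) • Finset.univ.image d)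
    (hsplit : ∀ t : ℝ, 0 < t → (∑ k ∈ Finset.range (r + 1), (X : ℝ[X]) ^ k * Polynomial.C ((c k).eval t)).Splits)
    (hfin : {p : Fin 2 → ℝ | 0 < p 0 ∧ 0 < p 1 ∧ MvPolynomial.eval p Φ = 0 ∧
      MvPolynomial.eval p
        (MvPolynomial.X 0 * MvPolynomial.pderiv 0 (MvPolynomial.X 0 * MvPolynomial.pderiv 0 Φ)
            * (MvPolynomial.X 1 * MvPolynomial.pderiv 1 Φ) ^ 2
          - 2 * (MvPolynomial.X 0 * MvPolynomial.pderiv 0 (MvPolynomial.X 1 * MvPolynomial.pderiv 1 Φ))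
            * (MvPolynomial.X 0 * MvPolynomial.pderiv 0 Φ) * (MvPolynomial.X 1 * MvPolynomial.pderiv 1 Φ)
          + MvPolynomial.X 1 * MvPolynomial.pderiv 1 (MvPolynomial.X 1 * MvPolynomial.pderiv 1 Φ)
            * (MvPolynomial.X 0 * MvPolynomial.pderiv 0 Φ) ^ 2) = 0}.Finite) :
    {p : Fin 2 → ℝ | 0 < p 0 ∧ 0 < p 1 ∧ MvPolynomial.eval p Φ = 0 ∧
      MvPolynomial.eval p
        (MvPolynomial.X 0 * MvPolynomial.pderiv 0 (MvPolynomial.X 0 * MvPolynomial.pderiv 0 Φ)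
            * (MvPolynomial.X 1 * MvPolynomial.pderiv 1 Φ) ^ 2
          - 2 * (MvPolynomial.X 0 * MvPolynomial.pderiv 0 (MvPolynomial.X 1 * MvPolynomial.pderiv 1 Φ))
            * (MvPolynomial.X 0 * MvPolynomial.pderiv 0 Φ) * (MvPolynomial.X 1 * MvPolynomial.pderiv 1 Φ)
          + MvPolynomial.X 1 * MvPolynomial.pderiv 1 (MvPolynomial.X 1 * MvPolynomial.pderiv 1 Φ)
            * (MvPolynomial.X 0 * MvPolynomial.pderiv 0 Φ) ^ 2) = 0}.ncard ≤ (r + s) * Nat.multichoose K (20 * (r + s) ^ 2) := by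
  have hr : r ≤ r + s := Nat.le_add_right r s
  have hP := isobaric_PP (Finset.univ.image d) c r (r + s) hr hc
  have hQ := isobaric_HH (Finset.univ.image d) c r (r + s) hr hc
  have hsplit' : ∀ t : ℝ, 0 < t → ((∑ k ∈ Finset.range (r + 1), C (c k) * X ^ k : ℝ[X][X]).map (evalRingHom t)).Splits := by
    intro t ht; rw [PP_map_eq]; exact hsplit t ht
  have key := uniform_count_multichoose (Finset.univ.image d) _ _ (r + s) (3 * (r + s)) hP.1 hP.2 hQ.1 hQ.2 hsplit'
    (fun t h => HH_map_eq_zero c r t h) _ (fun p => ?_) hfin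
  · refine key.trans (final_arith_multichoose (r + s) K _ ?_)
    exact Finset.card_image_le.trans (by rw [Finset.card_univ, Fintype.card_fin])
  · rw [Set.mem_setOf_eq, eval_logHessian_sum c r Φ hΦ p, hΦ, eval_sum_letter, ← eval_map_PP]
    exact Iff.rfl

end OsculationUniform

namespace OsculationUniformRung

/-- **`OsculationLawAt m K (m · multichoose K (20 m²))` for EVERY format `m`** (the line's `OsculationLawAt` UNFOLDED verbatim) —
`2^(O(K · log m))`; NOT the LAW `2^(C (K + log² m))`. -/
theorem osculationLawAt_all_multichoose (m K : ℕ) :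
    ∀ (r s : ℕ), r + s = m → ∀ (d : Fin K → ℕ) (S : Fin K → Matrix (Fin r ⊕ Fin s) (Fin r ⊕ Fin s) ℝ),
      (∀ l, (S l).IsSymm) →
      {p : Fin 2 → ℝ | 0 < p 0 ∧ 0 < p 1 ∧ MvPolynomial.eval p (∑ l, (MvPolynomial.X (0 : Fin 2) : MvPolynomial (Fin 2) ℝ) ^ d l •
              (S l).map (MvPolynomial.C : ℝ →+* MvPolynomial (Fin 2) ℝ)
            + (MvPolynomial.X (1 : Fin 2) : MvPolynomial (Fin 2) ℝ) •
              (Matrix.fromBlocks 1 0 0 0 : Matrix (Fin r ⊕ Fin s) (Fin r ⊕ Fin s) ℝ).map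
                (MvPolynomial.C : ℝ →+* MvPolynomial (Fin 2) ℝ)).det = 0 ∧
      MvPolynomial.eval p
        (MvPolynomial.X 0 * MvPolynomial.pderiv 0 (MvPolynomial.X 0 * MvPolynomial.pderiv 0 (∑ l, (MvPolynomial.X (0 : Fin 2) : MvPolynomial (Fin 2) ℝ) ^ d l •
              (S l).map (MvPolynomial.C : ℝ →+* MvPolynomial (Fin 2) ℝ)
            + (MvPolynomial.X (1 : Fin 2) : MvPolynomial (Fin 2) ℝ) •
              (Matrix.fromBlocks 1 0 0 0 : Matrix (Fin r ⊕ Fin s) (Fin r ⊕ Fin s) ℝ).map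
                (MvPolynomial.C : ℝ →+* MvPolynomial (Fin 2) ℝ)).det)
            * (MvPolynomial.X 1 * MvPolynomial.pderiv 1 (∑ l, (MvPolynomial.X (0 : Fin 2) : MvPolynomial (Fin 2) ℝ) ^ d l •
              (S l).map (MvPolynomial.C : ℝ →+* MvPolynomial (Fin 2) ℝ)
            + (MvPolynomial.X (1 : Fin 2) : MvPolynomial (Fin 2) ℝ) •
              (Matrix.fromBlocks 1 0 0 0 : Matrix (Fin r ⊕ Fin s) (Fin r ⊕ Fin s) ℝ).map
                (MvPolynomial.C : ℝ →+* MvPolynomial (Fin 2) ℝ)).det) ^ 2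
          - 2 * (MvPolynomial.X 0 * MvPolynomial.pderiv 0 (MvPolynomial.X 1 * MvPolynomial.pderiv 1 (∑ l, (MvPolynomial.X (0 : Fin 2) : MvPolynomial (Fin 2) ℝ) ^ d l •
              (S l).map (MvPolynomial.C : ℝ →+* MvPolynomial (Fin 2) ℝ)
            + (MvPolynomial.X (1 : Fin 2) : MvPolynomial (Fin 2) ℝ) •
              (Matrix.fromBlocks 1 0 0 0 : Matrix (Fin r ⊕ Fin s) (Fin r ⊕ Fin s) ℝ).map
                (MvPolynomial.C : ℝ →+* MvPolynomial (Fin 2) ℝ)).det))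
            * (MvPolynomial.X 0 * MvPolynomial.pderiv 0 (∑ l, (MvPolynomial.X (0 : Fin 2) : MvPolynomial (Fin 2) ℝ) ^ d l •
              (S l).map (MvPolynomial.C : ℝ →+* MvPolynomial (Fin 2) ℝ)
            + (MvPolynomial.X (1 : Fin 2) : MvPolynomial (Fin 2) ℝ) •
              (Matrix.fromBlocks 1 0 0 0 : Matrix (Fin r ⊕ Fin s) (Fin r ⊕ Fin s) ℝ).map
                (MvPolynomial.C : ℝ →+* MvPolynomial (Fin 2) ℝ)).det) * (MvPolynomial.X 1 * MvPolynomial.pderiv 1 (∑ l, (MvPolynomial.X (0 : Fin 2) : MvPolynomial (Fin 2) ℝ) ^ d l •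
              (S l).map (MvPolynomial.C : ℝ →+* MvPolynomial (Fin 2) ℝ)
            + (MvPolynomial.X (1 : Fin 2) : MvPolynomial (Fin 2) ℝ) •
              (Matrix.fromBlocks 1 0 0 0 : Matrix (Fin r ⊕ Fin s) (Fin r ⊕ Fin s) ℝ).map
                (MvPolynomial.C : ℝ →+* MvPolynomial (Fin 2) ℝ)).det)
          + MvPolynomial.X 1 * MvPolynomial.pderiv 1 (MvPolynomial.X 1 * MvPolynomial.pderiv 1 (∑ l, (MvPolynomial.X (0 : Fin 2) : MvPolynomial (Fin 2) ℝ) ^ d l •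
              (S l).map (MvPolynomial.C : ℝ →+* MvPolynomial (Fin 2) ℝ)
            + (MvPolynomial.X (1 : Fin 2) : MvPolynomial (Fin 2) ℝ) •
              (Matrix.fromBlocks 1 0 0 0 : Matrix (Fin r ⊕ Fin s) (Fin r ⊕ Fin s) ℝ).map
                (MvPolynomial.C : ℝ →+* MvPolynomial (Fin 2) ℝ)).det)
            * (MvPolynomial.X 0 * MvPolynomial.pderiv 0 (∑ l, (MvPolynomial.X (0 : Fin 2) : MvPolynomial (Fin 2) ℝ) ^ d l •
              (S l).map (MvPolynomial.C : ℝ →+* MvPolynomial (Fin 2) ℝ)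
            + (MvPolynomial.X (1 : Fin 2) : MvPolynomial (Fin 2) ℝ) •
              (Matrix.fromBlocks 1 0 0 0 : Matrix (Fin r ⊕ Fin s) (Fin r ⊕ Fin s) ℝ).map
                (MvPolynomial.C : ℝ →+* MvPolynomial (Fin 2) ℝ)).det) ^ 2) = 0}.Finite →
      {p : Fin 2 → ℝ | 0 < p 0 ∧ 0 < p 1 ∧ MvPolynomial.eval p (∑ l, (MvPolynomial.X (0 : Fin 2) : MvPolynomial (Fin 2) ℝ) ^ d l •
              (S l).map (MvPolynomial.C : ℝ →+* MvPolynomial (Fin 2) ℝ)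
            + (MvPolynomial.X (1 : Fin 2) : MvPolynomial (Fin 2) ℝ) •
              (Matrix.fromBlocks 1 0 0 0 : Matrix (Fin r ⊕ Fin s) (Fin r ⊕ Fin s) ℝ).map
                (MvPolynomial.C : ℝ →+* MvPolynomial (Fin 2) ℝ)).det = 0 ∧
      MvPolynomial.eval p
        (MvPolynomial.X 0 * MvPolynomial.pderiv 0 (MvPolynomial.X 0 * MvPolynomial.pderiv 0 (∑ l, (MvPolynomial.X (0 : Fin 2) : MvPolynomial (Fin 2) ℝ) ^ d l •
              (S l).map (MvPolynomial.C : ℝ →+* MvPolynomial (Fin 2) ℝ)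
            + (MvPolynomial.X (1 : Fin 2) : MvPolynomial (Fin 2) ℝ) •
              (Matrix.fromBlocks 1 0 0 0 : Matrix (Fin r ⊕ Fin s) (Fin r ⊕ Fin s) ℝ).map
                (MvPolynomial.C : ℝ →+* MvPolynomial (Fin 2) ℝ)).det)
            * (MvPolynomial.X 1 * MvPolynomial.pderiv 1 (∑ l, (MvPolynomial.X (0 : Fin 2) : MvPolynomial (Fin 2) ℝ) ^ d l •
              (S l).map (MvPolynomial.C : ℝ →+* MvPolynomial (Fin 2) ℝ)
            + (MvPolynomial.X (1 : Fin 2) : MvPolynomial (Fin 2) ℝ) •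
              (Matrix.fromBlocks 1 0 0 0 : Matrix (Fin r ⊕ Fin s) (Fin r ⊕ Fin s) ℝ).map
                (MvPolynomial.C : ℝ →+* MvPolynomial (Fin 2) ℝ)).det) ^ 2
          - 2 * (MvPolynomial.X 0 * MvPolynomial.pderiv 0 (MvPolynomial.X 1 * MvPolynomial.pderiv 1 (∑ l, (MvPolynomial.X (0 : Fin 2) : MvPolynomial (Fin 2) ℝ) ^ d l •
              (S l).map (MvPolynomial.C : ℝ →+* MvPolynomial (Fin 2) ℝ)
            + (MvPolynomial.X (1 : Fin 2) : MvPolynomial (Fin 2) ℝ) •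
              (Matrix.fromBlocks 1 0 0 0 : Matrix (Fin r ⊕ Fin s) (Fin r ⊕ Fin s) ℝ).map
                (MvPolynomial.C : ℝ →+* MvPolynomial (Fin 2) ℝ)).det))
            * (MvPolynomial.X 0 * MvPolynomial.pderiv 0 (∑ l, (MvPolynomial.X (0 : Fin 2) : MvPolynomial (Fin 2) ℝ) ^ d l •
              (S l).map (MvPolynomial.C : ℝ →+* MvPolynomial (Fin 2) ℝ)
            + (MvPolynomial.X (1 : Fin 2) : MvPolynomial (Fin 2) ℝ) •
              (Matrix.fromBlocks 1 0 0 0 : Matrix (Fin r ⊕ Fin s) (Fin r ⊕ Fin s) ℝ).map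
                (MvPolynomial.C : ℝ →+* MvPolynomial (Fin 2) ℝ)).det) * (MvPolynomial.X 1 * MvPolynomial.pderiv 1 (∑ l, (MvPolynomial.X (0 : Fin 2) : MvPolynomial (Fin 2) ℝ) ^ d l •
              (S l).map (MvPolynomial.C : ℝ →+* MvPolynomial (Fin 2) ℝ)
            + (MvPolynomial.X (1 : Fin 2) : MvPolynomial (Fin 2) ℝ) •
              (Matrix.fromBlocks 1 0 0 0 : Matrix (Fin r ⊕ Fin s) (Fin r ⊕ Fin s) ℝ).map
                (MvPolynomial.C : ℝ →+* MvPolynomial (Fin 2) ℝ)).det)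
          + MvPolynomial.X 1 * MvPolynomial.pderiv 1 (MvPolynomial.X 1 * MvPolynomial.pderiv 1 (∑ l, (MvPolynomial.X (0 : Fin 2) : MvPolynomial (Fin 2) ℝ) ^ d l •
              (S l).map (MvPolynomial.C : ℝ →+* MvPolynomial (Fin 2) ℝ)
            + (MvPolynomial.X (1 : Fin 2) : MvPolynomial (Fin 2) ℝ) •
              (Matrix.fromBlocks 1 0 0 0 : Matrix (Fin r ⊕ Fin s) (Fin r ⊕ Fin s) ℝ).map
                (MvPolynomial.C : ℝ →+* MvPolynomial (Fin 2) ℝ)).det)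
            * (MvPolynomial.X 0 * MvPolynomial.pderiv 0 (∑ l, (MvPolynomial.X (0 : Fin 2) : MvPolynomial (Fin 2) ℝ) ^ d l •
              (S l).map (MvPolynomial.C : ℝ →+* MvPolynomial (Fin 2) ℝ)
            + (MvPolynomial.X (1 : Fin 2) : MvPolynomial (Fin 2) ℝ) •
              (Matrix.fromBlocks 1 0 0 0 : Matrix (Fin r ⊕ Fin s) (Fin r ⊕ Fin s) ℝ).map
                (MvPolynomial.C : ℝ →+* MvPolynomial (Fin 2) ℝ)).det) ^ 2) = 0}.ncard ≤ m * Nat.multichoose K (20 * m ^ 2) := by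
  intro r s hrs d S hS hfin
  subst hrs
  exact OsculationUniform.column_of_family_multichoose r s K d _ _ (OsculationLetter.insertionPoly_rank_card r s d S)
    (fun k _ => OsculationLetter.supp_coeff_card r s d S k) (fun t _ => OsculationLetter.splits_letter_at r s d S hS t) hfin

end OsculationUniformRung

end Summit.ValiantsHypothesis.ValiantsHypothesis.Theorems.LacunarySymmetroidMatrixDescartes
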